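import Summits.QuantumFields.YangMills.Theorems.SqueezedSkewnessCollarBumpFloors
import Summits.QuantumFields.YangMills.Theorems.SqueezedSkewnessFemtoCurrencyGlue
import HarnessLib

/-!
# Route `SqueezedSkewness`, crux `FemtoFloorUnit` (stmt-QuantumFields-23545), LINE χ₂ «femto currency»: the registered stub
# `stub_collarBumpFloors` BY NAME AND SIGNATURE, and `FemtoFloorUnit ⇐ FemtoTwoPointUnit`

The registered birth skeleton `Cruxes/NT/Lines/femto_currency_birth.lean` (planner ym-idea-6 g12) serves the crux `FemtoFloorUnit`
through two name-keyed stubs, `__Registered.stub_femtoTwoPointUnit := SqueezedSkewness.FemtoTwoPointUnit` (23679, XL) and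
`__Registered.stub_collarBumpFloors := SqueezedSkewness.CollarBumpFloors` (23680), composed by the landed glue `FemtoCurrencyGlue`
(23681).  Item 23680 is CLOSED (`CollarBumpFloorsProof.collarBumpFloors_proof`, fleet lead g20, p676396); this file records the
registered STUB `theorem stub_collarBumpFloors : __Registered.stub_collarBumpFloors` by name and signature (registry hygiene: the stub
must not be re-proved by width seats), and the crux from its one remaining stub: `femtoFloorUnit_of_femtoTwoPointUnit`.

Fleet lead `ym-spine-19353-p1` g21 (`--supports stmt-QuantumFields-23545`).  THEOREMS ONLY (the `__Registered` abbreviation restates the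
skeleton's name-keyed statement verbatim, in this file's namespace, as in the precedent `SqueezedSkewnessElectricSeamStubSeamFromMoments`).
HONEST FRAMING: `FemtoTwoPointUnit` (23679: ∃ unit with the spine's `FBL6 ∧ FC2`) is OPEN and XL; no crux, NT statement, rung of record or
mass gap is proved by any of this. [folklore]
-/

set_option autoImplicit false

namespace Summit.QuantumFields.YangMills.Theorems.SqueezedSkewnessFemtoFloorUnitStub

open Summit.QuantumFields.YangMills.Theses.SqueezedSkewness

/-! ## Name-keyed statement of the registered stub (verbatim from the birth skeleton) -/
namespace __Registered

/-- Statement of `stub_collarBumpFloors` = `SqueezedSkewness.CollarBumpFloors` (stmt-QuantumFields-23680, support L) BY NAME. -/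
abbrev stub_collarBumpFloors : Prop :=
  Summit.QuantumFields.YangMills.Theses.SqueezedSkewness.CollarBumpFloors

end __Registered

/-! ## The registered STUB `stub_collarBumpFloors`, by name and signature -/

/-- **STUB `stub_collarBumpFloors` HOLDS** (registered on stmt-QuantumFields-23545): in any unit `a → 0⁺`, `FBL6 ∧ FC2 ⇒` the femto-window
reflection floors of `Qrp` for bumps of every radius — the landed `CollarBumpFloorsProof.collarBumpFloors_proof` (transport identity
`Qrp = Q2(θf, f) − Cov_P(D_f∘refl, B_f)`, windowed two-point floor from `FBL ∧ FC2`, electric cross term `O(a)` from `MomentBounds6`).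
[folklore] -/
theorem stub_collarBumpFloors : __Registered.stub_collarBumpFloors :=
  Summit.QuantumFields.YangMills.Theorems.CollarBumpFloorsProof.collarBumpFloors_proof

/-! ## The crux from its one remaining stub -/

/-- **`FemtoTwoPointUnit → FemtoFloorUnit`** (stmt-QuantumFields-23545 BY NAME from 23679 alone): the landed glue
`squeezedSkewness_femtoCurrencyGlue_proof` with its `CollarBumpFloors` input discharged. [folklore] -/
theorem femtoFloorUnit_of_femtoTwoPointUnit (h : FemtoTwoPointUnit) : FemtoFloorUnit :=
  Summit.QuantumFields.YangMills.Theorems.squeezedSkewness_femtoCurrencyGlue_proof h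
    Summit.QuantumFields.YangMills.Theorems.CollarBumpFloorsProof.collarBumpFloors_proof

end Summit.QuantumFields.YangMills.Theorems.SqueezedSkewnessFemtoFloorUnitStub
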